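import Literature.AlgebraicGeometry.HodgeTheory.WeilClassesFieldTensorNumberFieldDecomposable
import Literature.AlgebraicGeometry.HodgeTheory.WeilClassesFieldDecomposableOfMatrixBlocks
import Mathlib.LinearAlgebra.Lagrange
import Mathlib.FieldTheory.IsAlgClosed.Basic
import HarnessLib

/-!
# Moonen–Zarhin's Criterion (2), THE TYPE-1 ROW WITH REAL MULTIPLICATION OF ANY DEGREE: on `A^{n+1}` with the product
# polarization, every subfield `F ⊆ M_{n+1}(ℚ(ψ))` — `ψ ∈ End(A)` Rosati-symmetric with irreducible minimal polynomial —
# has decomposable, hence algebraic, Weil classes; with Milne's «the involution `D` defines on `C(A)` is the restriction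
# of the product of the involutions» for the biproduct (Moonen–Zarhin 1998 §1; Milne 1999 §1)

Layer `Literature/AlgebraicGeometry/HodgeTheory`; THEOREMS ONLY — no definition, no named fact, no `sorry` (D-0026, net
debt 0).  The INSTANCE of the seat's multi-block Morita mechanism (`WeilClassesFieldDecomposableOfMatrixBlocks`): the
blocks are the spectral projectors of the diagonal real multiplication times the matrix units of the power.

## The print

B. J. J. Moonen, Yu. G. Zarhin, *Weil classes on abelian varieties*, J. reine angew. Math. 496 (1998) 83–92 =
arXiv:alg-geom/9612017 [MoonenZarhin1998WeilClasses] (held text `paper:arxiv-alg-geom_9612017`), §1 Criterion (2)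
(chunk p0003 L46–L58) and its proof (L82–L90): for `X ∼ Y^m` with `Y` of TYPE 1 (`End⁰(Y) = E` a totally real field,
`B = M_m(E)`, «if `m ≥ 2` … then we simply have `Δ = D`»), EVERY subfield `F ⊆ End⁰(X)` has `W_F` consisting of
decomposable Hodge classes: «suppose that `F ⊆ B`, so that `G_div(X) ⊆ Gl_F(V_X)`.  In the cases we are considering,
the group `G_div(X)` is connected and semi-simple, so `G_div(X) ⊆ Sl_F(V_X)`».  The blocks (chunk p0002 L104–L118):
«`Δ ⊗ ℂ = ∏_{τ ∈ Σ_{E₀}} Δ_ℂ^{(τ)}` … `G_div(X) ⊗ ℂ` splits as the direct product of `e₀` factors `G_div^{(τ)}`».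
J. S. Milne, *Lefschetz classes on abelian varieties*, Duke Math. J. 96 (1999) [Milne1999LefschetzClasses], §1 p. 643:
«`D = Σᵢ A₁ × ⋯ × Dᵢ × ⋯ × A_s` is an ample divisor on `A`, and the involution it defines on `C(A)` is the restriction of
the product of the involutions defined by the `Dᵢ` on `C(Aᵢ)`.»

## What is proved (all on the carriers `H¹(A(ℂ); ℂ)`, `H¹(A^{n+1}(ℂ); ℂ)`; `D = Σ πᵢ^* h` the product class)

§1 Milne's slotwise involution on a finite biproduct `⨁ A` (every `dim Aᵢ > 0`):
* `polarizationPairingOne_sum_map_π_map_π_of_adjoint` — the diagonal blocks of `Q_D` inherit adjoints: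
  `Q_{hᵢ}(S a, b) = Q_{hᵢ}(a, S′ b) ⟹ Q_D(πᵢ^* S a, πᵢ^* b) = Q_D(πᵢ^* a, πᵢ^* S′ b)` (induction along
  `⨁_{Fin (n+1)} A ≅ A₀ × ⨁ (A ∘ succ)` from the tree's binary block formulas, which are linear in the factor pairing);
* `polarizationPairingOne_biproductMap_of_adjoint` — slotwise adjoints `gᵢ, g′ᵢ` give adjoint `⊕ gᵢ`, `⊕ g′ᵢ`;
* **`pullbackOne_biproductMap_mem_symmetricPullbackSpan`** — `⊕ gᵢ` is Rosati-symmetric for `D` when every `gᵢ` is for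
  `hᵢ`; in particular the diagonal real multiplication `ψ ⊕ ⋯ ⊕ ψ` on `A^{n+1}`.
§2 The matrix units `e_{ab} = (πₐ ≫ ι_b)^*` of `A^{n+1}`: `pullbackOne_π_comp_ι_mul` (`e_{ab} e_{cd} = δ_{bc} e_{ad}`),
`sum_pullbackOne_π_comp_ι` (`Σ e_{aa} = 1`), **`polarizationPairingOne_pullbackOne_π_comp_ι`** (`e_{ab}† = e_{ba}`:
«`α† = (α*_{ji})`», from the symmetric units of the seat's `WeilClassesFieldTensorNumberFieldDecomposable`).
§3 (private) polynomial calculus: intertwining `L q(f) = q(g) L`, commuting, and `B`-self-adjointness of `q(T)`.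
§4 **`aeval_lagrange_basis_spectral`** (any `ℂ`-vector space): for `T` killed by the nodal polynomial of a finite set
`s ⊂ ℂ`, the Lagrange projectors `P_z = ℓ_z(T)` satisfy `Σ P_z = 1`, `P_z P_{z′} = 0`, `P_z² = P_z`, `T P_z = z P_z`.
§5 **`weilClassesField_biproduct_le_divisorClassesSpan_of_mem_adjoin_diagonal`** — for `A` with `h ∈ B¹ ⊗ ℂ`,
`h^{dim} ≠ 0`, `Q_h` non-degenerate, `ψ^*` `Q_h`-symmetric with `Q(ψ) = 0` (`Q ∈ ℤ[T]` monic irreducible over `ℚ`), and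
`φ ∈ End(A^{n+1})` with `φ^* ∈ ℂ⟨(⊕ψ)^*, (πₐ ≫ ι_b)^*⟩` (`F ⊆ M_{n+1}(ℚ(ψ))`), `P(φ) = 0` (`P` monic irreducible of degree
`e`, `e · 2m = 2(n+1) dim A`): `W_F ⊗ ℂ ≤ 𝒟ᵐ ⊗ ℂ`; `…_le_hodgeClassSpan_…`, **`…_le_algebraicClasses_…`**,
`mem_algebraicClasses_of_mem_weilClassesField_biproduct_of_mem_adjoin_diagonal`.  The blocks fed to
`weilClassesField_le_divisorClassesSpan_of_matrixBlocks`: `κ` = the roots `z` of `Q` in `ℂ` (the real places of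
`E = ℚ(ψ)`), `x_{z,i} = P_z e_{i0}`, `y_{z,i} = P_z e_{0i}`, `p_z = P_z e_{00}` — `Q_D`-orthogonal since `P_z† = P_z`
(§1, §3) and `e_{i0}† = e_{0i}` (§2), inside `B ⊗ ℂ`, spanning `(⊕ψ)^* = Σ z P_z` and every `e_{ab} = Σ_z P_z e_{ab}`.

Scope (honest column).  This is the type-1 mechanism for the power `A^{n+1}` of ANY `A` carrying a Rosati-symmetric
`ψ` with irreducible minimal polynomial (no simplicity of `A`, no identification `End⁰(A) = ℚ(ψ)`): `F` ranges over the
subfields of `M_{n+1}(ℚ(ψ))`, which for `A` simple of type 1 with `End⁰(A) = ℚ(ψ)` is ALL of `End⁰(A^{n+1})` (the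
print's row in full, up to isogeny — the isogeny transport is the seat's `WeilClassesFieldIsogenyTransportOfStructure`).
The case `n + 1 = 1` is included (then `F ⊆ ℚ(ψ)`, the symmetric case).  The type-2 analogue with a centre of degree
`> 1` (quaternion pair × spectral projectors) is not written here.  No algebraic groups, connectedness or classification.

## References

* [MoonenZarhin1998WeilClasses] B. J. J. Moonen, Yu. G. Zarhin, Weil classes on abelian varieties, J. reine angew.
  Math. 496 (1998) 83–92; arXiv:alg-geom/9612017: §1 Criterion (2) and its proof (chunk p0003 L46–L90), Table 1,
  «Δ ⊗ ℂ = ∏ Δ^{(τ)}» (chunk p0002 L78–L118).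
* [Milne1999LefschetzClasses] J. S. Milne, Lefschetz classes on abelian varieties, Duke Math. J. 96 (1999), §1 p. 643,
  Thm. 3.2, Cor. 4.5.
* [LangeBirkenhake1992] H. Lange, Ch. Birkenhake, Complex Abelian Varieties (1992), §1.1, §5.1, §5.3.
* [McconnellRobson2001] J. C. McConnell, J. C. Robson, Noncommutative Noetherian Rings, GSM 30 (AMS 2001), 3.5.5–3.5.7.
* [HornJohnson2013] R. A. Horn, C. R. Johnson, Matrix Analysis, 2nd ed. (CUP 2013), §1.1 and §1.3 (Lagrange
  interpolation and the spectral resolution of a diagonalisable operator).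
* [vanGeemen1994HodgeAV] B. van Geemen, LNM 1594 (1994), §2.4.
* [VoisinHodgeI2002] C. Voisin, Hodge Theory and Complex Algebraic Geometry I (CUP 2002), Thm. 11.30.

## Provenance

Lane `lit-hodgefound` (Track 2, Layer A), prover seat `lit-hodgefound-p21` (generation 21), row g21-#3 (the instance
announced in g21-#2 `WeilClassesFieldDecomposableOfMatrixBlocks`).
-/

noncomputable section

open CategoryTheory CategoryTheory.Limits
open Literature.AlgebraicTopology.SingularHomology
open Literature.AlgebraicGeometry.Motives
open Literature.AlgebraicGeometry.VanGeemen1994 (hodgeClassSpan pullbackOne)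
open Literature.AlgebraicGeometry.Milne1999
open Literature.AlgebraicGeometry.Pohlmann1968 (sum_map_π_map_ι map_biproductMap_map_π)
open Literature.Geometry.Kaehler (lefschetzPow)
open Literature.Barriers.HodgeConjecture (divisorClassesSpan)
open Literature.LinearAlgebra
open Polynomial

namespace Literature.AlgebraicGeometry.HodgeTheory

section SlotwiseRosati

/-- **The diagonal blocks of `Q_D` inherit the adjoints of the factors**: on `⨁ A` with `D = Σ πᵢ^* hᵢ`, if `S`
and `S'` on `H¹(Aᵢ)` are ADJOINT for `Q_{hᵢ}` (`Q_{hᵢ}(S a, b) = Q_{hᵢ}(a, S' b)`), then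
`Q_D(πᵢ^* S a, πᵢ^* b) = Q_D(πᵢ^* a, πᵢ^* S' b)` — by induction along `⨁_{Fin (n+1)} A ≅ A₀ × ⨁ (A ∘ succ)` from the
binary block formulas `Q_D(pr₁^* a, pr₁^* a') = C · pr₁^*(Q_{h₀}(a, a')) ⌣ pr₂^*(h'^{dim})` and
`Q_D(pr₂^* b, pr₂^* b') = C' · pr₁^*(h₀^{dim}) ⌣ pr₂^*(Q_{h'}(b, b'))`, which are LINEAR in the factor pairing («the
involution it [`D`] defines on `C(A)` is the restriction of the product of the involutions defined by the `Dᵢ` on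
`C(Aᵢ)`»). [cite: Milne1999LefschetzClasses, §1 p. 643] [cite: LangeBirkenhake1992, §5.3] -/
theorem polarizationPairingOne_sum_map_π_map_π_of_adjoint : ∀ {n : ℕ} (A : Fin (n + 1) → AbelianVariety ℂ)
    (h : ∀ i, complexBetti (A i).X 2), (∀ i, 0 < (A i).dim) → ∀ (i : Fin (n + 1))
    (S S' : Module.End ℂ (complexBetti (A i).X 1)),
    (∀ a b, polarizationPairingOne (A i).X (h i) ((A i).dim - 1) (S a) b =
      polarizationPairingOne (A i).X (h i) ((A i).dim - 1) a (S' b)) →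
    ∀ a b : complexBetti (A i).X 1,
      polarizationPairingOne (⨁ A).X (sumPolarizationClass A h) ((⨁ A).dim - 1)
          (complexBetti.map (biproduct.π A i).hom.hom.hom 1 (S a)) (complexBetti.map (biproduct.π A i).hom.hom.hom 1 b) =
        polarizationPairingOne (⨁ A).X (sumPolarizationClass A h) ((⨁ A).dim - 1)
          (complexBetti.map (biproduct.π A i).hom.hom.hom 1 a) (complexBetti.map (biproduct.π A i).hom.hom.hom 1 (S' b))
  | 0, A, h, _, i, S, S', hS, a, b => by
    have hi : i = 0 := Fin.fin_one_eq_zero i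
    subst hi
    have hd : (⨁ A).dim - 1 = (A 0).dim - 1 := by
      rw [AbelianVariety.dim_eq_of_isIsogeny (isIsogeny_biproduct_π_fin_one A)]
    rw [hd, sumPolarizationClass_fin_one, ← map_polarizationPairingOne, ← map_polarizationPairingOne, hS]
  | n + 1, A, h, h0, i, S, S', hS, a, b => by
    have hB0 : 0 < (A 0).dim := h0 0
    have hC0 : 0 < (⨁ fun i : Fin (n + 1) => A i.succ).dim := dim_biproduct_pos _ (h0 _)
    have hd : (⨁ A).dim - 1 = ((A 0).prod (⨁ fun i : Fin (n + 1) => A i.succ)).dim - 1 := by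
      rw [AbelianVariety.dim_eq_of_isIsogeny (isIsogeny_biproductSuccSplit A)]
    rw [hd, ← map_biproductSuccSplit_prodPolarizationClass]
    revert S S' a b
    refine Fin.cases ?_ (fun i' => ?_) i
    · intro S S' hS a b
      rw [← map_biproductSuccSplit_map_fst A (S a), ← map_biproductSuccSplit_map_fst A b,
        ← map_biproductSuccSplit_map_fst A a, ← map_biproductSuccSplit_map_fst A (S' b),
        ← map_polarizationPairingOne, ← map_polarizationPairingOne,
        polarizationPairingOne_prod_map_fst_map_fst _ _ hB0 hC0, polarizationPairingOne_prod_map_fst_map_fst _ _ hB0 hC0,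
        hS]
    · intro S S' hS a b
      rw [← map_biproductSuccSplit_map_snd_map_π A i' (S a), ← map_biproductSuccSplit_map_snd_map_π A i' b,
        ← map_biproductSuccSplit_map_snd_map_π A i' a, ← map_biproductSuccSplit_map_snd_map_π A i' (S' b),
        ← map_polarizationPairingOne, ← map_polarizationPairingOne,
        polarizationPairingOne_prod_map_snd_map_snd _ _ hB0 hC0, polarizationPairingOne_prod_map_snd_map_snd _ _ hB0 hC0,
        polarizationPairingOne_sum_map_π_map_π_of_adjoint (fun i : Fin (n + 1) => A i.succ) (fun i => h i.succ)
          (fun i => h0 _) i' S S' hS a b]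

/-- **A componentwise endomorphism with Rosati-adjoint slots has the componentwise adjoint**: for `g, g' : ∀ i, Aᵢ ⟶ Aᵢ`
with `Q_{hᵢ}(gᵢ^* a, b) = Q_{hᵢ}(a, g'ᵢ^* b)` for every `i`, the pull-backs of `⊕ gᵢ` and `⊕ g'ᵢ` are adjoint for
`Q_D` on `H¹(⨁ A)`, `D = Σ πᵢ^* hᵢ` (`0 < dim Aᵢ`): `H¹(⨁ A) = ⊕ πᵢ^* H¹(Aᵢ)`, the mixed blocks of `Q_D` vanish and the
diagonal blocks inherit the adjoints («the involution `D` defines on `C(A)` is the restriction of the product of the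
involutions»). [cite: Milne1999LefschetzClasses, §1 p. 643] [cite: LangeBirkenhake1992, §5.3] -/
theorem polarizationPairingOne_biproductMap_of_adjoint {n : ℕ} (A : Fin (n + 1) → AbelianVariety ℂ)
    (h : ∀ i, complexBetti (A i).X 2) (h0 : ∀ i, 0 < (A i).dim) (g g' : ∀ i, A i ⟶ A i)
    (hg : ∀ i (a b : complexBetti (A i).X 1),
      polarizationPairingOne (A i).X (h i) ((A i).dim - 1) (complexBetti.map (g i).hom.hom.hom 1 a) b =
        polarizationPairingOne (A i).X (h i) ((A i).dim - 1) a (complexBetti.map (g' i).hom.hom.hom 1 b))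
    (x y : complexBetti (⨁ A).X 1) :
    polarizationPairingOne (⨁ A).X (sumPolarizationClass A h) ((⨁ A).dim - 1)
        (complexBetti.map (biproduct.map g).hom.hom.hom 1 x) y =
      polarizationPairingOne (⨁ A).X (sumPolarizationClass A h) ((⨁ A).dim - 1) x
        (complexBetti.map (biproduct.map g').hom.hom.hom 1 y) := by
  classical
  set xs := fun j ↦ complexBetti.map (biproduct.ι A j).hom.hom.hom 1 x with hxs
  set ys := fun j ↦ complexBetti.map (biproduct.ι A j).hom.hom.hom 1 y with hys
  have hx : complexBetti.map (biproduct.map g).hom.hom.hom 1 x =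
      ∑ i, complexBetti.map (biproduct.π A i).hom.hom.hom 1 (complexBetti.map (g i).hom.hom.hom 1 (xs i)) := by
    conv_lhs => rw [← sum_map_π_map_ι A x, map_sum]
    exact Finset.sum_congr rfl fun i _ ↦ map_biproductMap_map_π A g i 1 (xs i)
  have hy' : complexBetti.map (biproduct.map g').hom.hom.hom 1 y =
      ∑ j, complexBetti.map (biproduct.π A j).hom.hom.hom 1 (complexBetti.map (g' j).hom.hom.hom 1 (ys j)) := by
    conv_lhs => rw [← sum_map_π_map_ι A y, map_sum]
    exact Finset.sum_congr rfl fun j _ ↦ map_biproductMap_map_π A g' j 1 (ys j)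
  have hx0 : x = ∑ i, complexBetti.map (biproduct.π A i).hom.hom.hom 1 (xs i) := (sum_map_π_map_ι A x).symm
  have hy0 : y = ∑ j, complexBetti.map (biproduct.π A j).hom.hom.hom 1 (ys j) := (sum_map_π_map_ι A y).symm
  rw [hx, hy']
  rw [hy0] -- the left `y`
  conv_rhs => rw [hx0]
  simp only [map_sum, LinearMap.sum_apply]
  refine Finset.sum_congr rfl fun i _ ↦ Finset.sum_congr rfl fun j _ ↦ ?_
  by_cases hij : i = j
  · subst hij
    exact polarizationPairingOne_sum_map_π_map_π_of_adjoint A h h0 i _ _ (hg i) (xs i) (ys i)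
  · rw [polarizationPairingOne_sum_map_π_map_π_of_ne A h h0 (Ne.symm hij),
      polarizationPairingOne_sum_map_π_map_π_of_ne A h h0 (Ne.symm hij)]

/-- **`⊕ gᵢ` IS ROSATI-SYMMETRIC WHEN EVERY SLOT IS**: for `gᵢ^*` `Q_{hᵢ}`-symmetric on `H¹(Aᵢ)` (`0 < dim Aᵢ`), the
pull-back `(⊕ gᵢ)^*` lies in `S_D ⊗ ℂ = symmetricPullbackSpan (⨁ A) D`, `D = Σ πᵢ^* hᵢ` — in particular the DIAGONAL
ACTION `ψ ⊕ ⋯ ⊕ ψ` of a Rosati-symmetric `ψ ∈ End(A)` (real multiplication) on `A^{n+1}` is Rosati-symmetric for the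
product polarization. [cite: Milne1999LefschetzClasses, §1 p. 643] [cite: MoonenZarhin1998WeilClasses, §1 (S_λ of X = Y^m with the product polarization μ^m: «α† = (α*_{ji})»; chunk p0002 L78–L84)]
[cite: LangeBirkenhake1992, §5.3] -/
theorem pullbackOne_biproductMap_mem_symmetricPullbackSpan {n : ℕ} (A : Fin (n + 1) → AbelianVariety ℂ)
    (h : ∀ i, complexBetti (A i).X 2) (h0 : ∀ i, 0 < (A i).dim) (g : ∀ i, A i ⟶ A i)
    (hg : ∀ i (a b : complexBetti (A i).X 1),
      polarizationPairingOne (A i).X (h i) ((A i).dim - 1) (pullbackOne (A i) (g i) a) b =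
        polarizationPairingOne (A i).X (h i) ((A i).dim - 1) a (pullbackOne (A i) (g i) b)) :
    pullbackOne (⨁ A) (biproduct.map g) ∈ symmetricPullbackSpan (⨁ A) (sumPolarizationClass A h) :=
  ⟨Submodule.subset_span ⟨biproduct.map g, rfl⟩,
    fun x y ↦ polarizationPairingOne_biproductMap_of_adjoint A h h0 g g hg x y⟩

end SlotwiseRosati


/-! ### §2 The matrix units `(πₐ ≫ ι_b)^*` of `H¹(A^{n+1}) = ⊕ πₐ^* H¹(A)` and their Rosati adjoints -/

section Units

variable {A : AbelianVariety ℂ} {h : complexBetti A.X 2} {n : ℕ}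

/-- `(f ≫ g)^* = f^* ∘ g^*` on `H¹`, in `Module.End`. [folklore] -/
private theorem pullbackOne_comp' {Y : AbelianVariety ℂ} (f g : Y ⟶ Y) :
    pullbackOne Y (f ≫ g) = pullbackOne Y f * pullbackOne Y g := by
  change (complexBetti.map (f.hom.hom.hom ≫ g.hom.hom.hom) 1).hom = _
  rw [complexBetti.map_comp, ModuleCat.hom_comp]
  rfl

/-- `0^* = 0` on `H¹`. [folklore] -/
private theorem pullbackOne_zero' {Y : AbelianVariety ℂ} : pullbackOne Y (0 : Y ⟶ Y) = 0 := by
  change (complexBetti.map (0 : Y ⟶ Y).hom.hom.hom 1).hom = 0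
  rw [complexBetti_map_zero_one, ModuleCat.hom_zero]

/-- `(f + g)^* = f^* + g^*` on `H¹`. [folklore] -/
private theorem pullbackOne_add' {Y : AbelianVariety ℂ} (f g : Y ⟶ Y) :
    pullbackOne Y (f + g) = pullbackOne Y f + pullbackOne Y g := by
  change (complexBetti.map (f + g).hom.hom.hom 1).hom = _
  rw [complexBetti_map_add_one, ModuleCat.hom_add]

/-- `(πₐ ≫ ι_b)^* x = πₐ^* (ι_b^* x)`. [folklore] -/
private theorem pullbackOne_π_comp_ι_apply' (a b : Fin (n + 1)) (x : complexBetti (⨁ (fun _ : Fin (n + 1) => A)).X 1) :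
    pullbackOne (⨁ (fun _ : Fin (n + 1) => A))
      (biproduct.π (fun _ : Fin (n + 1) => A) a ≫ biproduct.ι (fun _ : Fin (n + 1) => A) b) x =
      complexBetti.map (biproduct.π (fun _ : Fin (n + 1) => A) a).hom.hom.hom 1
          (complexBetti.map (biproduct.ι (fun _ : Fin (n + 1) => A) b).hom.hom.hom 1 x) := by
  change singularCohomology.map ℂ ℂ _ 1 x = singularCohomology.map ℂ ℂ _ 1 (singularCohomology.map ℂ ℂ _ 1 x)
  rw [abelianVarietyHom_map_map_apply]

/-- **The matrix units multiply as `e_{ab} e_{cd} = δ_{bc} e_{ad}`**: `(πₐ ≫ ι_b)^* (π_c ≫ ι_d)^* = δ_{bc} (πₐ ≫ ι_d)^*`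
(`ι_b ≫ π_c = δ_{bc}`). [cite: McconnellRobson2001, 3.5.5–3.5.6] [cite: LangeBirkenhake1992, §1.1] -/
theorem pullbackOne_π_comp_ι_mul (a b c d : Fin (n + 1)) :
    pullbackOne (⨁ (fun _ : Fin (n + 1) => A))
        (biproduct.π (fun _ : Fin (n + 1) => A) a ≫ biproduct.ι (fun _ : Fin (n + 1) => A) b) *
      pullbackOne (⨁ (fun _ : Fin (n + 1) => A))
        (biproduct.π (fun _ : Fin (n + 1) => A) c ≫ biproduct.ι (fun _ : Fin (n + 1) => A) d) =
      if b = c then pullbackOne (⨁ (fun _ : Fin (n + 1) => A))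
        (biproduct.π (fun _ : Fin (n + 1) => A) a ≫ biproduct.ι (fun _ : Fin (n + 1) => A) d) else 0 := by
  rw [← pullbackOne_comp', Category.assoc]
  by_cases hbc : b = c
  · subst hbc
    rw [biproduct.ι_π_self_assoc, if_pos rfl]
  · rw [biproduct.ι_π_ne_assoc _ hbc, Limits.zero_comp, Limits.comp_zero, pullbackOne_zero', if_neg hbc]

/-- **`Σₐ e_{aa} = 1`**: `Σₐ (πₐ ≫ ιₐ)^* = 1` on `H¹(A^{n+1})` (`Σ πₐ ≫ ιₐ = 𝟙`). [cite: McconnellRobson2001, 3.5.5–3.5.6] [cite: LangeBirkenhake1992, §1.1] -/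
theorem sum_pullbackOne_π_comp_ι :
    ∑ a, pullbackOne (⨁ (fun _ : Fin (n + 1) => A))
      (biproduct.π (fun _ : Fin (n + 1) => A) a ≫ biproduct.ι (fun _ : Fin (n + 1) => A) a) = 1 := by
  refine LinearMap.ext fun v ↦ ?_
  rw [LinearMap.sum_apply, Module.End.one_apply]
  conv_rhs => rw [← sum_map_π_map_ι (fun _ : Fin (n + 1) => A) v]
  exact Finset.sum_congr rfl fun a _ ↦ pullbackOne_π_comp_ι_apply' a a v

/-- **The Rosati adjoint of a matrix unit is the transposed unit**: `Q_D((πₐ ≫ ι_b)^* v, w) = Q_D(v, (π_b ≫ ιₐ)^* w)` for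
the product class `D = Σ πᵢ^* h` (`h ∈ B¹ ⊗ ℂ`, `h^{dim} ≠ 0`, `Q_h` non-degenerate; from the symmetric units `e_{aa}` and
`e_{ab} + e_{ba}` of the seat's `WeilClassesFieldTensorNumberFieldDecomposable`: «`α† = (α*_{ji})`» for the product
polarization). [cite: MoonenZarhin1998WeilClasses, §1 (S_λ of X = Y^m, «α† = (α*_{ji})»; chunk p0002 L78–L84)]
[cite: Milne1999LefschetzClasses, §1 p. 643] [cite: LangeBirkenhake1992, §5.1 and §5.3] -/
theorem polarizationPairingOne_pullbackOne_π_comp_ι (hA : 0 < A.dim) (hh : h ∈ hodgeClassSpan A.dim A.X 1)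
    (htop : lefschetzPow h (A.dim - 1) 2 h ≠ 0)
    (hnd : ∀ x : complexBetti A.X 1, (∀ y, polarizationPairingOne A.X h (A.dim - 1) x y = 0) → x = 0)
    (a b : Fin (n + 1)) (v w : complexBetti (⨁ (fun _ : Fin (n + 1) => A)).X 1) :
    polarizationPairingOne (⨁ (fun _ : Fin (n + 1) => A)).X (sumPolarizationClass (fun _ : Fin (n + 1) => A) fun _ => h)
        ((⨁ (fun _ : Fin (n + 1) => A)).dim - 1)
        (pullbackOne (⨁ (fun _ : Fin (n + 1) => A))
          (biproduct.π (fun _ : Fin (n + 1) => A) a ≫ biproduct.ι (fun _ : Fin (n + 1) => A) b) v) w =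
      polarizationPairingOne (⨁ (fun _ : Fin (n + 1) => A)).X (sumPolarizationClass (fun _ : Fin (n + 1) => A) fun _ => h)
        ((⨁ (fun _ : Fin (n + 1) => A)).dim - 1) v
        (pullbackOne (⨁ (fun _ : Fin (n + 1) => A))
          (biproduct.π (fun _ : Fin (n + 1) => A) b ≫ biproduct.ι (fun _ : Fin (n + 1) => A) a) w) := by
  by_cases hab : a = b
  · subst hab
    exact (pullbackOne_π_comp_ι_self_mem_symmetricPullbackSpan (h := h) hA a).2 v w
  · have haa := (pullbackOne_π_comp_ι_self_mem_symmetricPullbackSpan (h := h) (n := n) hA a).2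
    have hS := (pullbackOne_π_comp_ι_add_mem_symmetricPullbackSpan (n := n) hA hh htop hnd a b).2
    have hba : b ≠ a := fun e ↦ hab e.symm
    have e1 : pullbackOne (⨁ (fun _ : Fin (n + 1) => A))
          (biproduct.π (fun _ : Fin (n + 1) => A) a ≫ biproduct.ι (fun _ : Fin (n + 1) => A) b) =
        pullbackOne (⨁ (fun _ : Fin (n + 1) => A))
            (biproduct.π (fun _ : Fin (n + 1) => A) a ≫ biproduct.ι (fun _ : Fin (n + 1) => A) a) *
          pullbackOne (⨁ (fun _ : Fin (n + 1) => A))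
            (biproduct.π (fun _ : Fin (n + 1) => A) a ≫ biproduct.ι (fun _ : Fin (n + 1) => A) b +
              biproduct.π (fun _ : Fin (n + 1) => A) b ≫ biproduct.ι (fun _ : Fin (n + 1) => A) a) := by
      rw [pullbackOne_add', mul_add, pullbackOne_π_comp_ι_mul, pullbackOne_π_comp_ι_mul, if_pos rfl, if_neg hab, add_zero]
    have e2 : pullbackOne (⨁ (fun _ : Fin (n + 1) => A))
            (biproduct.π (fun _ : Fin (n + 1) => A) a ≫ biproduct.ι (fun _ : Fin (n + 1) => A) b +
              biproduct.π (fun _ : Fin (n + 1) => A) b ≫ biproduct.ι (fun _ : Fin (n + 1) => A) a) *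
          pullbackOne (⨁ (fun _ : Fin (n + 1) => A))
            (biproduct.π (fun _ : Fin (n + 1) => A) a ≫ biproduct.ι (fun _ : Fin (n + 1) => A) a) =
        pullbackOne (⨁ (fun _ : Fin (n + 1) => A))
          (biproduct.π (fun _ : Fin (n + 1) => A) b ≫ biproduct.ι (fun _ : Fin (n + 1) => A) a) := by
      rw [pullbackOne_add', add_mul, pullbackOne_π_comp_ι_mul, pullbackOne_π_comp_ι_mul, if_neg hba, if_pos rfl, zero_add]
    rw [e1, Module.End.mul_apply, haa, hS, ← Module.End.mul_apply, e2]

end Units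

/-! ### §3 Polynomials in a symmetric operator; intertwining; commuting -/

section Aeval

variable {M : Type*} [AddCommGroup M] [Module ℂ M]

/-- `L ∘ q(f) = q(g) ∘ L` when `L ∘ f = g ∘ L`. [folklore] -/
private theorem apply_aeval_of_comm {N : Type*} [AddCommGroup N] [Module ℂ N] (L : M →ₗ[ℂ] N) (f : Module.End ℂ M)
    (g : Module.End ℂ N) (hc : ∀ v, L (f v) = g (L v)) (q : ℂ[X]) (v : M) :
    L (aeval f q v) = aeval g q (L v) := by
  induction q using Polynomial.induction_on' generalizing v with
  | add p q hp hq => rw [map_add, map_add, LinearMap.add_apply, LinearMap.add_apply, map_add, hp, hq]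
  | monomial k c =>
    rw [aeval_monomial, aeval_monomial, Module.End.mul_apply, Module.End.mul_apply,
      Module.algebraMap_end_apply, Module.algebraMap_end_apply, map_smul]
    congr 1
    induction k generalizing v with
    | zero => rw [pow_zero, pow_zero, Module.End.one_apply, Module.End.one_apply]
    | succ k ih => rw [pow_succ, pow_succ, Module.End.mul_apply, Module.End.mul_apply, ih, hc]

/-- `q(T)` commutes with `U` when `T` does. [folklore] -/
private theorem aeval_mul_comm_of_comm (T U : Module.End ℂ M) (hc : T * U = U * T) (q : ℂ[X]) :
    aeval T q * U = U * aeval T q := by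
  refine LinearMap.ext fun v ↦ ?_
  rw [Module.End.mul_apply, Module.End.mul_apply]
  exact (apply_aeval_of_comm U T T (fun v ↦ by rw [← Module.End.mul_apply, ← hc, Module.End.mul_apply]) q v).symm

/-- A polynomial in a `B`-self-adjoint operator is `B`-self-adjoint, for any bilinear map `B`. [folklore] -/
private theorem bilin_aeval_symm {W : Type*} [AddCommGroup W] [Module ℂ W] (B : M →ₗ[ℂ] M →ₗ[ℂ] W)
    (T : Module.End ℂ M) (hT : ∀ v w, B (T v) w = B v (T w)) (q : ℂ[X]) (v w : M) :
    B (aeval T q v) w = B v (aeval T q w) := by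
  induction q using Polynomial.induction_on' generalizing v w with
  | add p q hp hq => rw [map_add, LinearMap.add_apply, LinearMap.add_apply, map_add, LinearMap.add_apply, map_add, hp, hq]
  | monomial k c =>
    rw [aeval_monomial, Module.End.mul_apply, Module.End.mul_apply, Module.algebraMap_end_apply,
      Module.algebraMap_end_apply, map_smul, LinearMap.smul_apply, map_smul]
    congr 1
    induction k generalizing v w with
    | zero => rw [pow_zero, Module.End.one_apply, Module.End.one_apply]
    | succ k ih =>
      conv_lhs => rw [pow_succ', Module.End.mul_apply]
      rw [hT, ih, ← Module.End.mul_apply, ← pow_succ]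

end Aeval

/-! ### §4 The spectral projectors of a diagonalisable operator with prescribed simple spectrum (Lagrange) -/

section Spectral

variable {M : Type*} [AddCommGroup M] [Module ℂ M]

/-- **Lagrange's spectral projectors.** For an operator `T` killed by the nodal polynomial `∏_{z ∈ s} (X - z)` of a finite
set `s ⊂ ℂ`, the operators `P_z = ℓ_z(T)` (`ℓ_z` the Lagrange basis polynomial at `z`) satisfy `Σ_z P_z = 1`,
`P_z P_{z'} = 0` (`z ≠ z'`), `P_z² = P_z` and `T P_z = z P_z`. [cite: HornJohnson2013, §1.1 and Thm. 1.3.7 ff. (Lagrange interpolation / spectral resolution of a diagonalisable matrix)] -/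
theorem aeval_lagrange_basis_spectral (T : Module.End ℂ M) (s : Finset ℂ) (hs : s.Nonempty)
    (hT : aeval T (Lagrange.nodal s id) = 0) :
    (∑ z ∈ s, aeval T (Lagrange.basis s id z) = 1) ∧
    (∀ z ∈ s, ∀ z' ∈ s, z ≠ z' → aeval T (Lagrange.basis s id z) * aeval T (Lagrange.basis s id z') = 0) ∧
    (∀ z ∈ s, aeval T (Lagrange.basis s id z) * aeval T (Lagrange.basis s id z) = aeval T (Lagrange.basis s id z)) ∧
    (∀ z ∈ s, T * aeval T (Lagrange.basis s id z) = z • aeval T (Lagrange.basis s id z)) := by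
  classical
  have hinj : Set.InjOn (id : ℂ → ℂ) s := Set.injOn_id _
  have hsum : ∑ z ∈ s, aeval T (Lagrange.basis s id z) = 1 := by
    rw [← map_sum, Lagrange.sum_basis hinj hs, map_one]
  have hbasis : ∀ z ∈ s, Lagrange.basis s id z = C (Lagrange.nodalWeight s id z) * Lagrange.nodal (s.erase z) id := by
    intro z hz
    rw [Lagrange.basis_eq_prod_sub_inv_mul_nodal_div hz, Lagrange.nodal_erase_eq_nodal_div hz]
  have horth : ∀ z ∈ s, ∀ z' ∈ s, z ≠ z' →
      aeval T (Lagrange.basis s id z) * aeval T (Lagrange.basis s id z') = 0 := by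
    intro z hz z' hz' hzz'
    have hz'e : z' ∈ s.erase z := Finset.mem_erase.2 ⟨fun e ↦ hzz' e.symm, hz'⟩
    have hdvd : Lagrange.nodal s id ∣ Lagrange.basis s id z * Lagrange.basis s id z' := by
      rw [hbasis z hz, hbasis z' hz', Lagrange.nodal_eq_mul_nodal_erase hz'e,
        Lagrange.nodal_eq_mul_nodal_erase (s := s) hz']
      exact ⟨C (Lagrange.nodalWeight s id z) * Lagrange.nodal ((s.erase z).erase z') id *
        C (Lagrange.nodalWeight s id z'), by ring⟩
    obtain ⟨r, hr⟩ := hdvd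
    rw [← map_mul, hr, map_mul, hT, zero_mul]
  refine ⟨hsum, horth, fun z hz ↦ ?_, fun z hz ↦ ?_⟩
  · -- `P_z² = P_z` from `P_z (Σ P_{z'}) = P_z`
    have h1 := congrArg (fun F ↦ aeval T (Lagrange.basis s id z) * F) hsum
    simp only [Finset.mul_sum, mul_one] at h1
    rw [Finset.sum_eq_single z (fun z' hz' hne ↦ horth z hz z' hz' (Ne.symm hne)) (fun h ↦ absurd hz h)] at h1
    exact h1
  · -- `T P_z = z P_z` from `(X - z) ℓ_z = w_z · nodal`
    have hpoly : (Polynomial.X - C z) * Lagrange.basis s id z = C (Lagrange.nodalWeight s id z) * Lagrange.nodal s id := by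
      rw [hbasis z hz, Lagrange.nodal_eq_mul_nodal_erase hz, mul_left_comm]
      rfl
    have h2 := congrArg (aeval T) hpoly
    rw [map_mul, map_mul, hT, mul_zero, map_sub, aeval_X, aeval_C, sub_mul, sub_eq_zero,
      Module.algebraMap_end_eq_smul_id, smul_mul_assoc] at h2
    rw [h2]
    rfl

end Spectral


/-! ### §5 The type-1 row: `F ⊆ M_{n+1}(ℚ(ψ))` acting on `A^{n+1}`, `ψ` Rosati-symmetric — `W_F` is decomposable -/

section RealMultiplicationMatrices

variable {A : AbelianVariety ℂ} {h : complexBetti A.X 2} {n : ℕ} {ψ : A ⟶ A}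
  {φ : ⨁ (fun _ : Fin (n + 1) => A) ⟶ ⨁ (fun _ : Fin (n + 1) => A)} {P Q : Polynomial ℤ} {e m : ℕ}

/-- The complex roots of a monic integer polynomial irreducible over `ℚ`: they are simple, non-empty, and their nodal
polynomial is the polynomial itself. [folklore] -/
private theorem nodal_rootsFinset_eq (hQm : Q.Monic) (hQirr : Irreducible (Q.map (Int.castRingHom ℚ))) :
    Lagrange.nodal (Q.map (Int.castRingHom ℂ)).roots.toFinset id = Q.map (Int.castRingHom ℂ) ∧
      (Q.map (Int.castRingHom ℂ)).roots.toFinset.Nonempty := by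
  classical
  have hQc : Q.map (Int.castRingHom ℂ) = (Q.map (Int.castRingHom ℚ)).map (algebraMap ℚ ℂ) := by
    rw [Polynomial.map_map, RingHom.ext_int ((algebraMap ℚ ℂ).comp (Int.castRingHom ℚ)) (Int.castRingHom ℂ)]
  have hsep : (Q.map (Int.castRingHom ℂ)).Separable := by
    rw [hQc]
    exact hQirr.separable.map
  have hmon : (Q.map (Int.castRingHom ℂ)).Monic := hQm.map _
  have hnodup : (Q.map (Int.castRingHom ℂ)).roots.Nodup := Polynomial.nodup_roots hsep
  refine ⟨?_, ?_⟩
  · have hsplit := (IsAlgClosed.splits (Q.map (Int.castRingHom ℂ))).eq_prod_roots_of_monic hmon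
    rw [Lagrange.nodal_eq, ← Multiset.toFinset_eq hnodup, Finset.prod_mk]
    exact hsplit.symm
  · have hdeg : (Q.map (Int.castRingHom ℂ)).degree ≠ 0 := by
      have h1 : 0 < (Q.map (Int.castRingHom ℚ)).natDegree :=
        Polynomial.natDegree_pos_iff_degree_pos.2 (Polynomial.degree_pos_of_irreducible hQirr)
      rw [hQm.natDegree_map] at h1
      intro h0
      rw [Polynomial.degree_eq_natDegree hmon.ne_zero, hQm.natDegree_map] at h0
      exact h1.ne' (by exact_mod_cast h0)
    obtain ⟨z, hz⟩ := IsAlgClosed.exists_root _ hdeg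
    exact ⟨z, Multiset.mem_toFinset.2 ((Polynomial.mem_roots hmon.ne_zero).2 hz)⟩

/-- **THE TYPE-1 ROW WITH REAL MULTIPLICATION OF ANY DEGREE — `W_F(A^{n+1})` IS DECOMPOSABLE FOR EVERY SUBFIELD
`F ⊆ M_{n+1}(ℚ(ψ))`.** Let `A` be a complex abelian variety of positive dimension with `h ∈ B¹(A) ⊗ ℂ`, `h^{dim A} ≠ 0`,
`Q_h` non-degenerate; `ψ ∈ End(A)` ROSATI-SYMMETRIC (`Q_h(ψ^* v, w) = Q_h(v, ψ^* w)` — real multiplication) with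
`Q(ψ) = 0` for a monic `Q ∈ ℤ[T]` irreducible over `ℚ` (so `E = ℚ(ψ)` is a totally real field of degree `deg Q`); let
`X = A^{n+1}` carry the product polarization `D = Σ πᵢ^* h`, and let `φ ∈ End(X)` have `φ^*` in the complex algebra
generated by the diagonal `(ψ ⊕ ⋯ ⊕ ψ)^*` and the matrix units `(πₐ ≫ ι_b)^*` — i.e. `F = ℚ(φ) ⊆ M_{n+1}(E) ⊆ End⁰(X)` —
with `P(φ) = 0`, `P ∈ ℤ[T]` monic irreducible of degree `e`, `e · 2m = 2 (n+1) dim A`. Then `W_F ⊗ ℂ ≤ 𝒟ᵐ ⊗ ℂ`: ALL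
WEIL CLASSES OF `F` ARE DECOMPOSABLE. Proof: the spectral projectors `P_z = ℓ_z((⊕ψ)^*)` (`z` the roots of `Q`,
Lagrange) and the units `e_{ab} = (πₐ ≫ ι_b)^*` give the `Q_D`-orthogonal system of matrix blocks
`x_{z,i} = P_z e_{i0}`, `y_{z,i} = P_z e_{0i}` inside `B ⊗ ℂ` (`(⊕ψ)^*` is Rosati-symmetric, §1; `e_{ab}† = e_{ba}`, §2),
whose span contains `(⊕ψ)^* = Σ z P_z` and every `e_{ab}`; then the multi-block Morita mechanism
(`weilClassesField_le_divisorClassesSpan_of_matrixBlocks`). This is the print's row «`Y` of Type 1, `F ⊆ B = End⁰(X)`: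
decomposable» for a totally real centre of ANY degree `e₀ = deg Q` (the blocks are the real places `z` of `E`), on
the carrier, with no algebraic groups. [cite: MoonenZarhin1998WeilClasses, §1 Criterion (2) and its proof, types 1–2 (chunk p0003 L46–L90); «Δ ⊗ ℂ = ∏_τ Δ_ℂ^{(τ)}» (chunk p0002 L104–L118)]
[cite: Milne1999LefschetzClasses, §1 p. 643, Thm. 3.2, Cor. 4.5] [cite: McconnellRobson2001, 3.5.5–3.5.7] -/
theorem weilClassesField_biproduct_le_divisorClassesSpan_of_mem_adjoin_diagonal (hA : 0 < A.dim)
    (hh : h ∈ hodgeClassSpan A.dim A.X 1) (htop : lefschetzPow h (A.dim - 1) 2 h ≠ 0)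
    (hnd : ∀ x : complexBetti A.X 1, (∀ y, polarizationPairingOne A.X h (A.dim - 1) x y = 0) → x = 0)
    (hψsym : ∀ v w : complexBetti A.X 1, polarizationPairingOne A.X h (A.dim - 1) (pullbackOne A ψ v) w =
      polarizationPairingOne A.X h (A.dim - 1) v (pullbackOne A ψ w))
    (hQm : Q.Monic) (hQirr : Irreducible (Q.map (Int.castRingHom ℚ)))
    (hψQ : Polynomial.eval₂ (Int.castRingHom (CategoryTheory.End A)) (ψ : CategoryTheory.End A) Q = 0)
    (hPm : P.Monic) (hPe : P.natDegree = e) (hPirr : Irreducible (P.map (Int.castRingHom ℚ)))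
    (hφ : Polynomial.eval₂ (Int.castRingHom (CategoryTheory.End (⨁ (fun _ : Fin (n + 1) => A))))
      (φ : CategoryTheory.End (⨁ (fun _ : Fin (n + 1) => A))) P = 0)
    (her : e * (2 * m) = 2 * ((n + 1) * A.dim))
    (hF : pullbackOne (⨁ (fun _ : Fin (n + 1) => A)) φ ∈ Algebra.adjoin ℂ
      (insert (pullbackOne (⨁ (fun _ : Fin (n + 1) => A)) (biproduct.map fun _ : Fin (n + 1) => ψ))
        (Set.range fun ab : Fin (n + 1) × Fin (n + 1) ↦ pullbackOne (⨁ (fun _ : Fin (n + 1) => A))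
          (biproduct.π (fun _ : Fin (n + 1) => A) ab.1 ≫ biproduct.ι (fun _ : Fin (n + 1) => A) ab.2)))) :
    weilClassesField (⨁ (fun _ : Fin (n + 1) => A)) φ P (2 * m) ≤
      divisorClassesSpan (⨁ (fun _ : Fin (n + 1) => A)).X (⨁ (fun _ : Fin (n + 1) => A)).dim m := by
  classical
  obtain ⟨hhX, -, hndX⟩ := sumPolarizationClass_hypotheses (fun _ : Fin (n + 1) => A) (fun _ => h)
      (fun _ => hA) (fun _ => hh) (fun _ => htop) (fun _ => hnd)
  have herX : e * (2 * m) = 2 * (⨁ (fun _ : Fin (n + 1) => A)).dim := by rw [dim_biproduct_const_succ A n, her]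
  -- notation
  set X := ⨁ (fun _ : Fin (n + 1) => A) with hXdef
  set D := sumPolarizationClass (fun _ : Fin (n + 1) => A) (fun _ => h) with hDdef
  set T : Module.End ℂ (complexBetti X.X 1) := pullbackOne X (biproduct.map fun _ : Fin (n + 1) => ψ) with hTdef
  set U : Fin (n + 1) → Fin (n + 1) → Module.End ℂ (complexBetti X.X 1) := fun a b ↦
    pullbackOne X (biproduct.π (fun _ : Fin (n + 1) => A) a ≫ biproduct.ι (fun _ : Fin (n + 1) => A) b) with hUdef
  have hU : ∀ a b c d, U a b * U c d = if b = c then U a d else 0 := fun a b c d ↦ pullbackOne_π_comp_ι_mul a b c d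
  have hUsum : ∑ a, U a a = 1 := sum_pullbackOne_π_comp_ι
  have hUadj : ∀ a b (v w : complexBetti X.X 1), polarizationPairingOne X.X D (X.dim - 1) (U a b v) w =
      polarizationPairingOne X.X D (X.dim - 1) v (U b a w) :=
    fun a b v w ↦ polarizationPairingOne_pullbackOne_π_comp_ι hA hh htop hnd a b v w
  have hUadjoin : ∀ a b, U a b ∈ Algebra.adjoin ℂ (symmetricPullbackSpan X D : Set (Module.End ℂ (complexBetti X.X 1))) :=
    fun a b ↦ pullbackOne_π_comp_ι_mem_adjoin_symmetricPullbackSpan hA hh htop hnd a b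
  -- the diagonal `T = (⊕ψ)^*`
  have hT_symm : T ∈ symmetricPullbackSpan X D :=
    pullbackOne_biproductMap_mem_symmetricPullbackSpan (fun _ : Fin (n + 1) => A) (fun _ => h) (fun _ => hA)
      (fun _ => ψ) (fun _ => hψsym)
  have hTU : ∀ a b, T * U a b = U a b * T := by
    intro a b
    rw [hTdef, hUdef, ← pullbackOne_comp', ← pullbackOne_comp']
    simp only [Category.assoc, biproduct.map_π_assoc, biproduct.ι_map]
  have hTQ : aeval T (Q.map (Int.castRingHom ℂ)) = 0 := by
    have hψQ' := aeval_hom_complexBetti_map_one_eq_zero hψQ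
    refine LinearMap.ext fun v ↦ ?_
    rw [LinearMap.zero_apply, ← sum_map_π_map_ι (fun _ : Fin (n + 1) => A) v, map_sum]
    refine Finset.sum_eq_zero fun a _ ↦ ?_
    have key := apply_aeval_of_comm (complexBetti.map (biproduct.π (fun _ : Fin (n + 1) => A) a).hom.hom.hom 1).hom
      (pullbackOne A ψ) T (fun c ↦ (map_biproductMap_map_π (fun _ : Fin (n + 1) => A) (fun _ => ψ) a 1 c).symm)
      (Q.map (Int.castRingHom ℂ)) (complexBetti.map (biproduct.ι (fun _ : Fin (n + 1) => A) a).hom.hom.hom 1 v)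
    rw [hψQ', LinearMap.zero_apply, map_zero] at key
    exact key.symm
  -- the spectral projectors of `T`
  set s : Finset ℂ := (Q.map (Int.castRingHom ℂ)).roots.toFinset with hsdef
  obtain ⟨hnodal, hsne⟩ := nodal_rootsFinset_eq hQm hQirr
  have hTnodal : aeval T (Lagrange.nodal s id) = 0 := by rw [hsdef, hnodal, hTQ]
  obtain ⟨hPsum, hPorth, hPidem, hTP⟩ := aeval_lagrange_basis_spectral T s hsne hTnodal
  set Pz : s → Module.End ℂ (complexBetti X.X 1) := fun z ↦ aeval T (Lagrange.basis s id (z : ℂ)) with hPzdef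
  have hPsum' : ∑ z : s, Pz z = 1 := by rw [Finset.sum_coe_sort s fun z ↦ aeval T (Lagrange.basis s id z), hPsum]
  have hPU : ∀ (z : s) a b, Pz z * U a b = U a b * Pz z := fun z a b ↦ aeval_mul_comm_of_comm T (U a b) (hTU a b) _
  have hPadj : ∀ (z : s) (v w : complexBetti X.X 1), polarizationPairingOne X.X D (X.dim - 1) (Pz z v) w =
      polarizationPairingOne X.X D (X.dim - 1) v (Pz z w) :=
    fun z v w ↦ bilin_aeval_symm _ T hT_symm.2 _ v w
  have hPadjoin : ∀ z : s, Pz z ∈ Algebra.adjoin ℂ (symmetricPullbackSpan X D : Set (Module.End ℂ (complexBetti X.X 1))) :=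
    fun z ↦ Algebra.adjoin_mono (Set.singleton_subset_iff.2 hT_symm) (Polynomial.aeval_mem_adjoin_singleton ℂ T)
  -- the blocks
  let x : s → Fin (n + 1) → Module.End ℂ (complexBetti X.X 1) := fun z i ↦ Pz z * U i 0
  let y : s → Fin (n + 1) → Module.End ℂ (complexBetti X.X 1) := fun z i ↦ Pz z * U 0 i
  let p : s → Module.End ℂ (complexBetti X.X 1) := fun z ↦ Pz z * U 0 0
  have hunit : ∀ (z : s) a b, x z a * y z b = Pz z * U a b := by
    intro z a b
    change Pz z * U a 0 * (Pz z * U 0 b) = Pz z * U a b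
    rw [mul_assoc, ← mul_assoc (U a 0), ← hPU, mul_assoc, hU, if_pos rfl, ← mul_assoc, hPidem _ z.2]
  have hxy : ∀ z i j, y z i * x z j = if i = j then p z else 0 := by
    intro z i j
    change Pz z * U 0 i * (Pz z * U j 0) = if i = j then Pz z * U 0 0 else 0
    rw [mul_assoc, ← mul_assoc (U 0 i), ← hPU, mul_assoc, hU, ← mul_assoc, hPidem _ z.2]
    split_ifs
    · rfl
    · rw [mul_zero]
  have hcross : ∀ z z', z ≠ z' → ∀ i j, y z i * x z' j = 0 := by
    intro z z' hzz' i j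
    change Pz z * U 0 i * (Pz z' * U j 0) = 0
    rw [mul_assoc, ← mul_assoc (U 0 i), ← hPU, mul_assoc, ← mul_assoc (Pz z),
      hPorth _ z.2 _ z'.2 (fun e ↦ hzz' (Subtype.ext e)), zero_mul]
  have hsum : ∑ z, ∑ i, x z i * y z i = 1 := by
    simp_rw [hunit, ← Finset.mul_sum, hUsum, mul_one]
    exact hPsum'
  have hadj : ∀ z i (v w : complexBetti X.X 1), polarizationPairingOne X.X D (X.dim - 1) (x z i v) w =
      polarizationPairingOne X.X D (X.dim - 1) v (y z i w) := by
    intro z i v w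
    change polarizationPairingOne X.X D (X.dim - 1) ((Pz z * U i 0) v) w =
      polarizationPairingOne X.X D (X.dim - 1) v ((Pz z * U 0 i) w)
    rw [Module.End.mul_apply, hPadj, hUadj, ← Module.End.mul_apply, ← hPU]
  have hx : ∀ z i, x z i ∈ Algebra.adjoin ℂ (symmetricPullbackSpan X D : Set (Module.End ℂ (complexBetti X.X 1))) :=
    fun z i ↦ Subalgebra.mul_mem _ (hPadjoin z) (hUadjoin i 0)
  have hy : ∀ z i, y z i ∈ Algebra.adjoin ℂ (symmetricPullbackSpan X D : Set (Module.End ℂ (complexBetti X.X 1))) :=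
    fun z i ↦ Subalgebra.mul_mem _ (hPadjoin z) (hUadjoin 0 i)
  -- the generators `T`, `e_{ab}` lie in the span of the blocks
  have hgen : insert T (Set.range fun ab : Fin (n + 1) × Fin (n + 1) ↦ U ab.1 ab.2) ⊆
      (Submodule.span ℂ (Set.range fun t : s × Fin (n + 1) × Fin (n + 1) ↦ x t.1 t.2.1 * y t.1 t.2.2) :
        Set (Module.End ℂ (complexBetti X.X 1))) := by
    have hUmem : ∀ a b, U a b ∈ Submodule.span ℂ (Set.range fun t : s × Fin (n + 1) × Fin (n + 1) ↦ x t.1 t.2.1 * y t.1 t.2.2) := by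
      intro a b
      have e1 : U a b = ∑ z : s, x z a * y z b := by
        simp_rw [hunit]
        rw [← Finset.sum_mul, hPsum', one_mul]
      rw [e1]
      exact Submodule.sum_mem _ fun z _ ↦ Submodule.subset_span ⟨(z, a, b), rfl⟩
    refine Set.insert_subset_iff.2 ⟨?_, ?_⟩
    · have e2 : T = ∑ z : s, ∑ i, (z : ℂ) • (x z i * y z i) := by
        simp_rw [hunit, ← smul_mul_assoc, ← Finset.mul_sum, hUsum, mul_one]
        rw [← mul_one T, ← hPsum', Finset.mul_sum]
        exact Finset.sum_congr rfl fun z _ ↦ hTP _ z.2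
      rw [e2]
      exact Submodule.sum_mem _ fun z _ ↦ Submodule.sum_mem _ fun i _ ↦
        Submodule.smul_mem _ _ (Submodule.subset_span ⟨(z, i, i), rfl⟩)
    · rintro _ ⟨ab, rfl⟩
      exact hUmem ab.1 ab.2
  exact weilClassesField_le_divisorClassesSpan_of_matrixBlocks hPm hPe hPirr hφ herX hhX hndX hxy hcross hsum hadj hx hy
    (adjoin_le_span_units_of_matrixBlocks hxy hcross hsum hgen hF)

/-- **… and consists of HODGE classes** (`W_F ⊗ ℂ ≤ ℬᵐ ⊗ ℂ`). [cite: MoonenZarhin1998WeilClasses, §1 Criterion (2) and the Remark after the Criterion («type 1, 2 or 3 ⟹ n_σ = n_σ′»; chunk p0002 L1–L12, p0003 L46–L58)]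
[cite: vanGeemen1994HodgeAV, §2.4] -/
theorem weilClassesField_biproduct_le_hodgeClassSpan_of_mem_adjoin_diagonal (hA : 0 < A.dim)
    (hh : h ∈ hodgeClassSpan A.dim A.X 1) (htop : lefschetzPow h (A.dim - 1) 2 h ≠ 0)
    (hnd : ∀ x : complexBetti A.X 1, (∀ y, polarizationPairingOne A.X h (A.dim - 1) x y = 0) → x = 0)
    (hψsym : ∀ v w : complexBetti A.X 1, polarizationPairingOne A.X h (A.dim - 1) (pullbackOne A ψ v) w =
      polarizationPairingOne A.X h (A.dim - 1) v (pullbackOne A ψ w))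
    (hQm : Q.Monic) (hQirr : Irreducible (Q.map (Int.castRingHom ℚ)))
    (hψQ : Polynomial.eval₂ (Int.castRingHom (CategoryTheory.End A)) (ψ : CategoryTheory.End A) Q = 0)
    (hPm : P.Monic) (hPe : P.natDegree = e) (hPirr : Irreducible (P.map (Int.castRingHom ℚ)))
    (hφ : Polynomial.eval₂ (Int.castRingHom (CategoryTheory.End (⨁ (fun _ : Fin (n + 1) => A))))
      (φ : CategoryTheory.End (⨁ (fun _ : Fin (n + 1) => A))) P = 0)
    (her : e * (2 * m) = 2 * ((n + 1) * A.dim))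
    (hF : pullbackOne (⨁ (fun _ : Fin (n + 1) => A)) φ ∈ Algebra.adjoin ℂ
      (insert (pullbackOne (⨁ (fun _ : Fin (n + 1) => A)) (biproduct.map fun _ : Fin (n + 1) => ψ))
        (Set.range fun ab : Fin (n + 1) × Fin (n + 1) ↦ pullbackOne (⨁ (fun _ : Fin (n + 1) => A))
          (biproduct.π (fun _ : Fin (n + 1) => A) ab.1 ≫ biproduct.ι (fun _ : Fin (n + 1) => A) ab.2)))) :
    weilClassesField (⨁ (fun _ : Fin (n + 1) => A)) φ P (2 * m) ≤
      hodgeClassSpan (⨁ (fun _ : Fin (n + 1) => A)).dim (⨁ (fun _ : Fin (n + 1) => A)).X m :=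
  (weilClassesField_biproduct_le_divisorClassesSpan_of_mem_adjoin_diagonal hA hh htop hnd hψsym hQm hQirr hψQ hPm hPe
      hPirr hφ her hF).trans
    (divisorClassesSpan_le_hodgeClassSpan_of_isSmoothProjective
      (AbelianVariety.isSmoothProjective_holds (A := ⨁ (fun _ : Fin (n + 1) => A))) m)

/-- **… and is ALGEBRAIC**: `W_F ⊗ ℂ ≤ algebraicClasses` — THE WEIL CLASSES OF EVERY SUBFIELD OF `M_{n+1}(ℚ(ψ))`
(`ψ` REAL MULTIPLICATION ON `A`) ON `A^{n+1}` ARE ALGEBRAIC, by the Lefschetz theorem on `(1,1)`-classes (the tree's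
`lefschetzOneOne_rational_holds`). [cite: MoonenZarhin1998WeilClasses, Introduction (chunk p0001 L10–L18) and §1 Criterion (2) (chunk p0003 L46–L90)]
[cite: VoisinHodgeI2002, Thm. 11.30] -/
theorem weilClassesField_biproduct_le_algebraicClasses_of_mem_adjoin_diagonal (hA : 0 < A.dim)
    (hh : h ∈ hodgeClassSpan A.dim A.X 1) (htop : lefschetzPow h (A.dim - 1) 2 h ≠ 0)
    (hnd : ∀ x : complexBetti A.X 1, (∀ y, polarizationPairingOne A.X h (A.dim - 1) x y = 0) → x = 0)
    (hψsym : ∀ v w : complexBetti A.X 1, polarizationPairingOne A.X h (A.dim - 1) (pullbackOne A ψ v) w =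
      polarizationPairingOne A.X h (A.dim - 1) v (pullbackOne A ψ w))
    (hQm : Q.Monic) (hQirr : Irreducible (Q.map (Int.castRingHom ℚ)))
    (hψQ : Polynomial.eval₂ (Int.castRingHom (CategoryTheory.End A)) (ψ : CategoryTheory.End A) Q = 0)
    (hPm : P.Monic) (hPe : P.natDegree = e) (hPirr : Irreducible (P.map (Int.castRingHom ℚ)))
    (hφ : Polynomial.eval₂ (Int.castRingHom (CategoryTheory.End (⨁ (fun _ : Fin (n + 1) => A))))
      (φ : CategoryTheory.End (⨁ (fun _ : Fin (n + 1) => A))) P = 0)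
    (her : e * (2 * m) = 2 * ((n + 1) * A.dim))
    (hF : pullbackOne (⨁ (fun _ : Fin (n + 1) => A)) φ ∈ Algebra.adjoin ℂ
      (insert (pullbackOne (⨁ (fun _ : Fin (n + 1) => A)) (biproduct.map fun _ : Fin (n + 1) => ψ))
        (Set.range fun ab : Fin (n + 1) × Fin (n + 1) ↦ pullbackOne (⨁ (fun _ : Fin (n + 1) => A))
          (biproduct.π (fun _ : Fin (n + 1) => A) ab.1 ≫ biproduct.ι (fun _ : Fin (n + 1) => A) ab.2)))) :
    weilClassesField (⨁ (fun _ : Fin (n + 1) => A)) φ P (2 * m) ≤ algebraicClasses (⨁ (fun _ : Fin (n + 1) => A)).X m :=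
  (weilClassesField_biproduct_le_divisorClassesSpan_of_mem_adjoin_diagonal hA hh htop hnd hψsym hQm hQirr hψQ hPm hPe
      hPirr hφ her hF).trans
    (AbelianVariety.divisorClassesSpan_le_algebraicClasses (⨁ (fun _ : Fin (n + 1) => A))
      (fun b hb hb' ↦ lefschetzOneOne_rational_holds
        (AbelianVariety.isSmoothProjective_holds (A := ⨁ (fun _ : Fin (n + 1) => A))) b hb hb') m)

/-- Element form: every class of `W_F ⊗ ℂ` — in particular every rational Weil class of a subfield of `M_{n+1}(ℚ(ψ))` on
`A^{n+1}` — is a `ℂ`-combination of algebraic classes. [cite: MoonenZarhin1998WeilClasses, Introduction (chunk p0001 L10–L18) and §1 Criterion (2) (chunk p0003 L46–L90)] -/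
theorem mem_algebraicClasses_of_mem_weilClassesField_biproduct_of_mem_adjoin_diagonal (hA : 0 < A.dim)
    (hh : h ∈ hodgeClassSpan A.dim A.X 1) (htop : lefschetzPow h (A.dim - 1) 2 h ≠ 0)
    (hnd : ∀ x : complexBetti A.X 1, (∀ y, polarizationPairingOne A.X h (A.dim - 1) x y = 0) → x = 0)
    (hψsym : ∀ v w : complexBetti A.X 1, polarizationPairingOne A.X h (A.dim - 1) (pullbackOne A ψ v) w =
      polarizationPairingOne A.X h (A.dim - 1) v (pullbackOne A ψ w))
    (hQm : Q.Monic) (hQirr : Irreducible (Q.map (Int.castRingHom ℚ)))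
    (hψQ : Polynomial.eval₂ (Int.castRingHom (CategoryTheory.End A)) (ψ : CategoryTheory.End A) Q = 0)
    (hPm : P.Monic) (hPe : P.natDegree = e) (hPirr : Irreducible (P.map (Int.castRingHom ℚ)))
    (hφ : Polynomial.eval₂ (Int.castRingHom (CategoryTheory.End (⨁ (fun _ : Fin (n + 1) => A))))
      (φ : CategoryTheory.End (⨁ (fun _ : Fin (n + 1) => A))) P = 0)
    (her : e * (2 * m) = 2 * ((n + 1) * A.dim))
    (hF : pullbackOne (⨁ (fun _ : Fin (n + 1) => A)) φ ∈ Algebra.adjoin ℂ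
      (insert (pullbackOne (⨁ (fun _ : Fin (n + 1) => A)) (biproduct.map fun _ : Fin (n + 1) => ψ))
        (Set.range fun ab : Fin (n + 1) × Fin (n + 1) ↦ pullbackOne (⨁ (fun _ : Fin (n + 1) => A))
          (biproduct.π (fun _ : Fin (n + 1) => A) ab.1 ≫ biproduct.ι (fun _ : Fin (n + 1) => A) ab.2))))
    {c : complexBetti (⨁ (fun _ : Fin (n + 1) => A)).X (2 * m)}
    (hc : c ∈ weilClassesField (⨁ (fun _ : Fin (n + 1) => A)) φ P (2 * m)) :
    c ∈ algebraicClasses (⨁ (fun _ : Fin (n + 1) => A)).X m :=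
  weilClassesField_biproduct_le_algebraicClasses_of_mem_adjoin_diagonal hA hh htop hnd hψsym hQm hQirr hψQ hPm hPe hPirr
    hφ her hF hc

end RealMultiplicationMatrices

end Literature.AlgebraicGeometry.HodgeTheory

end
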